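import Mathlib.Analysis.Calculus.ContDiff.Operations
import Mathlib.Analysis.Calculus.FDeriv.Prod
import Mathlib.Algebra.BigOperators.Fin
import Mathlib.Data.Fintype.WithTopBot
import Mathlib.LinearAlgebra.Basis.Prod
import Mathlib.Logic.Equiv.Option
import Literature.Analysis.Calculus.IteratedFDerivNestedPartials
import HarnessLib

/-!
# Mixed partials `∂ₜᵏ ∂_ζ-words` on `ℝ × Z` bound the joint jet (product words, sorted with the `ℝ`-letter first)

Topic `Analysis/Calculus`; namespace `Literature.Analysis.Calculus`.  THEOREMS ONLY (no `def`, no instance, no notation, no axiom, no named fact, no `sorry`);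
GENERIC multivariable calculus (Mathlib + ★ `IteratedFDerivNestedPartials` ∕ ★ `IteratedFDerivBasisBounds`).  Cell `pub/hodgecm-mathlib`, crux H413, line LH10 free
hand LH10-p02 (g6) on LH10-p01 (g4)'s OPEN OFFER «MIXED PARTIALS ⇒ JOINT JET on `ℝ × Z`» for the (α4-S6) «multi-wall Casimir» STEP file (S6-B5b), lane
`--supports stmt-HodgeConjecture-24833`; it pays no printed statement.  HONEST LABEL: HC_CM is proved only modulo the 7 printed citations (2 remaining:
hLiu418 = stmt-HodgeConjecture-24832, h413 = stmt-HodgeConjecture-24833) until rung 0 closes.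

THE MATHEMATICS (Hörmander ALPDO I §1.1: the `k`-th differential is the symmetric `k`-linear map of the mixed partials; Coleman §4.5).  Let `f : ℝ × Z → E` be `C^∞`
on an open `U`, `Z` a real normed space with a finite basis `b : κ → Z`, `κ` linearly ordered.
* §1 nested directional derivatives `D_{m 0} ⋯ D_{m (n-1)}` (`Fin.foldr`, the currency of ★ `iteratedFDeriv_apply_eq_foldr_fderiv`) preserve `C^∞(U)` and only see germs
  (`contDiffOn_foldr_fderiv_apply`, `foldr_fderiv_congr_of_eqOn`).
* §2 (D1) **slices**: nested derivatives of `f` along TANGENTIAL letters `(0, w j)`, evaluated at `(t, ζ)`, are the nested `ζ`-derivatives of the slice `ζ ↦ f (t, ζ)`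
  along `w j` (`foldr_fderiv_inr_eq_foldr_fderiv_slice`; chain rule through `ζ ↦ (t, ζ)`).
* §3 (D2) **THE DICTIONARY** `iteratedFDeriv_apply_append_eq_iteratedDeriv_slice`: for `(t₀, ζ₀) ∈ U`,
  `D^{k+l} f (t₀, ζ₀) [(1,0)^k ++ (0, w)] = (d/dt)^k |_{t₀} (t ↦ D^l (f(t, ·)) (ζ₀) [w])` (★ `iteratedFDeriv_apply_append_const_eq_iterate_foldr` + ★
  `iteratedDirDeriv_eq_iteratedDeriv_lineRestrict` along the line `(0, ζ₀) + t (1, 0)` + §2); `…_cast_…` is the same identity read at order `N` along `k + l = N`.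
* §4 (D3) **sorted product words**: the product basis of `ℝ × Z` indexed by `WithBot κ` (`⊥ ↦ (1, 0)`, `↑c ↦ (0, b c)`; `exists_basis_withBot_prod`) is ordered with the
  `ℝ`-letter FIRST, so a monotone word `I : Fin N → WithBot κ` is `⊥^k ++ ↑∘I'` with `I' : Fin l → κ` monotone, `k + l = N` (`exists_append_of_monotone_withBot`).
* §5 (D4) **HEAD** `exists_forall_norm_iteratedFDeriv_le_of_iteratedDeriv_partial`: if for every `k + l = N` and every monotone `I' : Fin l → κ` the mixed partial
  `(d/dt)^k D^l_ζ f(t, ·)(ζ)[b ∘ I']` is bounded on `A ⊆ U`, then `‖D^N f‖` is bounded on `A` (★ `exists_forall_norm_iteratedFDeriv_le_of_foldr_fderiv_basis_monotone`: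
  sorted words suffice by Schwarz).

* §6 (ED. 2, appended; §1–§5 byte-identical) **GENERAL TWO-BLOCK DICTIONARY on `P₁ × P₂`** (LH10-p01 (g4)'s extra heads for the `ℓ^∞`-family `Y`-jet bounds of
  (S6-B5b)): `foldr_fderiv_comp_clm_add_eq_foldr_fderiv` ((D1) through any affine pull-back `p ↦ A p + c`, `A` a continuous linear map),
  `iteratedFDeriv_apply_append_inl_inr` ((D2′) `D^{k+l} Ψ (x) [(u,0) ++ (0,m)] = D^k (p₁ ↦ D^l (Ψ(p₁, ·)) (x.2) [m]) (x.1) [u]`),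
  `contDiffOn_iteratedFDeriv_slice_apply` (the inner `ζ`-jet entry is `C^∞` in the outer variable on the slice set) and `norm_iteratedFDeriv_slice_apply_le`
  ((D2″) `‖D^k (p₁ ↦ D^l Ψ(p₁,·)(x.2)[m]) (x.1)‖ ≤ ‖D^{k+l} Ψ (x)‖ · ∏ ‖m j‖`, sup norm on the product).

## References
* [HormanderALPDO1] L. Hörmander, *The Analysis of Linear Partial Differential Operators I*, 2nd ed., Springer (1990), §1.1 pp. 7–12 ((1.1.3) chain rule; the `k`-th
  differential `f^{(k)}` as a symmetric multilinear map, Thm. 1.1.8; (1.1.7) derivatives along `t ↦ x + ty`).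
* [Coleman2012] R. Coleman, *Calculus on Normed Vector Spaces*, Universitext (2012), §4.5 «Higher differentials and higher derivatives» (mixed partials on a product).

## Mathlib ∕ tree search
★ `iteratedFDeriv_apply_eq_foldr_fderiv`, ★ `iteratedFDeriv_apply_append_const_eq_iterate_foldr`, ★ `exists_forall_norm_iteratedFDeriv_le_of_foldr_fderiv_basis_monotone`
(`IteratedFDerivNestedPartials`), ★ `iteratedDirDeriv_eq_iteratedDeriv_lineRestrict` (`IteratedFDerivBasisBounds` §3), ★ `contDiffOn_fderiv_apply_const_of_isOpen`
(`LaplacianCommutatorCarreDuChamp`, the one-step `C^∞` statement, used here as its one-line Mathlib term); Mathlib `hasFDerivAt_prodMk_right`, `contDiff_prodMk_right`,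
`Module.Basis.prod`∕`reindex`∕`singleton`, `Equiv.optionEquivSumPUnit`, `Fin.append_left∕_right`, `Fin.addCases`.  Nothing in the tree reads a JOINT jet on a product
`ℝ × Z` off one-variable `t`-jets of `ζ`-jets of slices.
-/

set_option autoImplicit false

noncomputable section

open Set Filter Topology Function
open scoped ContDiff

namespace Literature.Analysis.Calculus

/-! ## §1 Nested directional derivatives preserve `C^∞(U)` and only see germs -/

section Nested

variable {V : Type*} [NormedAddCommGroup V] [NormedSpace ℝ V] {E : Type*} [NormedAddCommGroup E] [NormedSpace ℝ E]

/-- **Nested directional derivatives of a `C^∞(U)` function are `C^∞(U)`** (`U` open): `D_{m 0} ⋯ D_{m (n-1)} g ∈ C^∞(U)` — induction on the word with the one-step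
statement `y ↦ Dg(y)·v ∈ C^∞(U)` (Mathlib `ContDiffOn.fderiv_of_isOpen` + `clm_apply`; ★ `contDiffOn_fderiv_apply_const_of_isOpen`).
[cite: HormanderALPDO1, §1.1 pp. 7–12] -/
theorem contDiffOn_foldr_fderiv_apply {U : Set V} (hU : IsOpen U) {n : ℕ} (m : Fin n → V) :
    ∀ {g : V → E}, ContDiffOn ℝ ∞ g U →
      ContDiffOn ℝ ∞ (Fin.foldr n (fun j (h : V → E) => fun y => fderiv ℝ h y (m j)) g) U := by
  induction n with
  | zero => intro g hg; simpa using hg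
  | succ n ih =>
    intro g hg
    rw [Fin.foldr_succ]
    exact ((ih (fun j => m j.succ) hg).fderiv_of_isOpen hU (m := ∞) (by simp)).clm_apply contDiffOn_const

/-- **Nested directional derivatives only see germs**: if `g₁ = g₂` on the open `U` then `D_{m 0} ⋯ D_{m (n-1)} g₁ = D_{m 0} ⋯ D_{m (n-1)} g₂` on `U`
(`Filter.EventuallyEq.fderiv_eq`, induction on the word). [cite: HormanderALPDO1, §1.1 pp. 7–12] -/
theorem foldr_fderiv_congr_of_eqOn {U : Set V} (hU : IsOpen U) {n : ℕ} (m : Fin n → V) :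
    ∀ {g₁ g₂ : V → E}, EqOn g₁ g₂ U →
      EqOn (Fin.foldr n (fun j (h : V → E) => fun y => fderiv ℝ h y (m j)) g₁)
        (Fin.foldr n (fun j (h : V → E) => fun y => fderiv ℝ h y (m j)) g₂) U := by
  induction n with
  | zero => intro g₁ g₂ h; simpa using h
  | succ n ih =>
    intro g₁ g₂ h y hy
    rw [Fin.foldr_succ, Fin.foldr_succ]
    show fderiv ℝ (Fin.foldr n (fun j (h : V → E) => fun y => fderiv ℝ h y (m j.succ)) g₁) y (m 0) =
      fderiv ℝ (Fin.foldr n (fun j (h : V → E) => fun y => fderiv ℝ h y (m j.succ)) g₂) y (m 0)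
    rw [((ih (fun j => m j.succ) h).eventuallyEq_of_mem (hU.mem_nhds hy)).fderiv_eq]

end Nested

/-! ## §2 (D1) Slices: tangential nested derivatives on `ℝ × Z` are nested derivatives of the slice -/

section Slices

variable {Z : Type*} [NormedAddCommGroup Z] [NormedSpace ℝ Z] {E : Type*} [NormedAddCommGroup E] [NormedSpace ℝ E]

omit [NormedSpace ℝ Z] in
/-- The slice set `{ζ | (t, ζ) ∈ U}` of an open `U ⊆ ℝ × Z` is open. [cite: HormanderALPDO1, §1.1 pp. 7–12] -/
theorem isOpen_slice_right {U : Set (ℝ × Z)} (hU : IsOpen U) (t : ℝ) : IsOpen {ζ : Z | (t, ζ) ∈ U} :=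
  hU.preimage (continuous_const.prodMk continuous_id)

omit [NormedSpace ℝ Z] in
/-- The slice set `{t | (t, ζ) ∈ U}` of an open `U ⊆ ℝ × Z` is open. [cite: HormanderALPDO1, §1.1 pp. 7–12] -/
theorem isOpen_slice_left {U : Set (ℝ × Z)} (hU : IsOpen U) (ζ : Z) : IsOpen {t : ℝ | (t, ζ) ∈ U} :=
  hU.preimage (continuous_id.prodMk continuous_const)

/-- The slice `ζ ↦ f (t, ζ)` of `f ∈ C^n(U)` is `C^n` on the slice set (chain rule, Mathlib `contDiff_prodMk_right`). [cite: HormanderALPDO1, §1.1 (1.1.3) p. 8] -/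
theorem contDiffOn_slice_right {U : Set (ℝ × Z)} {f : ℝ × Z → E} {n : WithTop ℕ∞} (hf : ContDiffOn ℝ n f U) (t : ℝ) :
    ContDiffOn ℝ n (fun ζ : Z => f (t, ζ)) {ζ : Z | (t, ζ) ∈ U} :=
  hf.comp (contDiff_prodMk_right t).contDiffOn fun _ hζ => hζ

/-- **One tangential derivative is a derivative of the slice**: for `g` differentiable at `(t, ζ)`,
`Dg(t, ζ)·(0, w) = D(ζ ↦ g(t, ζ))(ζ)·w` (chain rule through `ζ ↦ (t, ζ)`, whose derivative is `ContinuousLinearMap.inr`). [cite: HormanderALPDO1, §1.1 (1.1.3) p. 8] -/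
theorem fderiv_apply_inr_eq_fderiv_slice {g : ℝ × Z → E} {t : ℝ} {ζ : Z} (hg : DifferentiableAt ℝ g (t, ζ)) (w : Z) :
    fderiv ℝ g (t, ζ) ((0 : ℝ), w) = fderiv ℝ (fun η : Z => g (t, η)) ζ w := by
  have hcomp := hg.hasFDerivAt.comp ζ (hasFDerivAt_prodMk_right t ζ)
  rw [show (fun η : Z => g (t, η)) = g ∘ (fun η : Z => (t, η)) from rfl, hcomp.fderiv,
    ContinuousLinearMap.comp_apply, ContinuousLinearMap.inr_apply]

/-- **(D1) SLICES.**  For `g ∈ C^∞(U)`, `U ⊆ ℝ × Z` open, `(t, ζ) ∈ U` and tangential letters `w : Fin l → Z`: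
`(D_{(0, w 0)} ⋯ D_{(0, w (l-1))} g)(t, ζ) = (D_{w 0} ⋯ D_{w (l-1)} (ζ ↦ g (t, ζ)))(ζ)` — induction on the word (`Fin.foldr_succ_last`: innermost letter first), one
tangential derivative at a time (`fderiv_apply_inr_eq_fderiv_slice`), the outer word seeing only the germ on the open slice set (§1).
[cite: HormanderALPDO1, §1.1 pp. 7–12] [cite: Coleman2012, §4.5] -/
theorem foldr_fderiv_inr_eq_foldr_fderiv_slice {U : Set (ℝ × Z)} (hU : IsOpen U) {l : ℕ} (w : Fin l → Z) :
    ∀ {g : ℝ × Z → E}, ContDiffOn ℝ ∞ g U → ∀ {t : ℝ} {ζ : Z}, (t, ζ) ∈ U →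
      Fin.foldr l (fun j (h : ℝ × Z → E) => fun y => fderiv ℝ h y ((0 : ℝ), w j)) g (t, ζ) =
        Fin.foldr l (fun j (h : Z → E) => fun η => fderiv ℝ h η (w j)) (fun η => g (t, η)) ζ := by
  induction l with
  | zero => intro g _ t ζ _; simp
  | succ l ih =>
    intro g hg t ζ hmem
    rw [Fin.foldr_succ_last, Fin.foldr_succ_last]
    have hg' : ContDiffOn ℝ ∞ (fun y => fderiv ℝ g y ((0 : ℝ), w (Fin.last l))) U :=
      (hg.fderiv_of_isOpen hU (m := ∞) (by simp)).clm_apply contDiffOn_const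
    rw [ih (fun j => w j.castSucc) hg' hmem]
    -- the slice of `D_{(0, w last)} g` and `D_{w last}` of the slice agree on the open slice set
    refine foldr_fderiv_congr_of_eqOn (isOpen_slice_right hU t) (fun j => w j.castSucc) (fun η hη => ?_) hmem
    exact fderiv_apply_inr_eq_fderiv_slice
      ((hg.differentiableOn (by simp)).differentiableAt (hU.mem_nhds hη)) (w (Fin.last l))

end Slices

/-! ## §3 (D2) The dictionary: `(1,0)^k ++ (0,w)`-entries of the joint jet are `t`-derivatives of `ζ`-jets of slices -/

section Dictionary

variable {Z : Type*} [NormedAddCommGroup Z] [NormedSpace ℝ Z] {E : Type*} [NormedAddCommGroup E] [NormedSpace ℝ E]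

/-- The line `(0, ζ₀) + t • (1, 0)` in `ℝ × Z` is `t ↦ (t, ζ₀)` (plumbing). [cite: HormanderALPDO1, §1.1 (1.1.7) p. 11] -/
theorem zero_prod_add_smul_one_zero (ζ₀ : Z) (t : ℝ) :
    ((0 : ℝ), ζ₀) + t • ((1 : ℝ), (0 : Z)) = (t, ζ₀) := by
  ext <;> simp

/-- **(D2) THE DICTIONARY.**  For `f ∈ C^∞(U)`, `U ⊆ ℝ × Z` open, `x = (t₀, ζ₀) ∈ U`, `k : ℕ` and tangential letters `w : Fin l → Z`:
`D^{k+l} f (x) [(1,0), …, (1,0), (0, w 0), …, (0, w (l-1))] = (d/dt)^k (t ↦ D^l (ζ ↦ f (t, ζ)) (ζ₀) [w]) (t₀)`.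
Route: ★ `iteratedFDeriv_apply_append_const_eq_iterate_foldr` (`= (D_{(1,0)}^[k] (D_{(0,w)}-word f))(x)`), ★ `iteratedDirDeriv_eq_iteratedDeriv_lineRestrict` along the line
`(0, ζ₀) + t (1, 0)` (the nested word is `C^∞(U)` by §1), then near `t₀` the slices (D1) and ★ `iteratedFDeriv_apply_eq_foldr_fderiv` for the slice on its open
slice set (`Filter.EventuallyEq.iteratedDeriv_eq`). [cite: HormanderALPDO1, §1.1 pp. 7–12] [cite: Coleman2012, §4.5] -/
theorem iteratedFDeriv_apply_append_eq_iteratedDeriv_slice {U : Set (ℝ × Z)} (hU : IsOpen U) {f : ℝ × Z → E}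
    (hf : ContDiffOn ℝ ∞ f U) (k : ℕ) {l : ℕ} (w : Fin l → Z) {x : ℝ × Z} (hx : x ∈ U) :
    iteratedFDeriv ℝ (k + l) f x (Fin.append (fun _ : Fin k => ((1 : ℝ), (0 : Z))) (fun j => ((0 : ℝ), w j))) =
      iteratedDeriv k (fun t : ℝ => iteratedFDeriv ℝ l (fun ζ : Z => f (t, ζ)) x.2 w) x.1 := by
  obtain ⟨t₀, ζ₀⟩ := x
  have hf' : ContDiffOn ℝ (k + l) f U := hf.of_le (by exact_mod_cast le_top)
  rw [iteratedFDeriv_apply_append_const_eq_iterate_foldr hU hf' hx]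
  set G : ℝ × Z → E := Fin.foldr l (fun j (h : ℝ × Z → E) => fun y => fderiv ℝ h y ((0 : ℝ), w j)) f with hG
  have hGs : ContDiffOn ℝ ∞ G U := contDiffOn_foldr_fderiv_apply hU (fun j => ((0 : ℝ), w j)) hf
  -- the line through `(0, ζ₀)` in the direction `(1, 0)`
  have hJo : IsOpen {t : ℝ | (t, ζ₀) ∈ U} := isOpen_slice_left hU ζ₀
  have hJU : ∀ t ∈ {t : ℝ | (t, ζ₀) ∈ U}, ((0 : ℝ), ζ₀) + t • ((1 : ℝ), (0 : Z)) ∈ U := fun t ht => by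
    rw [zero_prod_add_smul_one_zero]; exact ht
  have h2 := iteratedDirDeriv_eq_iteratedDeriv_lineRestrict hU ((0 : ℝ), ζ₀) ((1 : ℝ), (0 : Z)) hJo hJU k hGs t₀ hx
  rw [zero_prod_add_smul_one_zero] at h2
  simp only [zero_prod_add_smul_one_zero] at h2
  change ((fun h : ℝ × Z → E => fun y => fderiv ℝ h y ((1 : ℝ), (0 : Z)))^[k] G) (t₀, ζ₀) = _
  rw [h2]
  -- near `t₀` the integrand is the `ζ`-jet of the slice
  refine Filter.EventuallyEq.iteratedDeriv_eq k ?_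
  filter_upwards [hJo.mem_nhds (show t₀ ∈ {t : ℝ | (t, ζ₀) ∈ U} from hx)] with s hs
  have hs' : (s, ζ₀) ∈ U := hs
  rw [hG, foldr_fderiv_inr_eq_foldr_fderiv_slice hU w hf hs']
  have hfs : ContDiffOn ℝ l (fun ζ : Z => f (s, ζ)) {ζ : Z | (s, ζ) ∈ U} :=
    contDiffOn_slice_right (hf.of_le (by exact_mod_cast le_top)) s
  exact (iteratedFDeriv_apply_eq_foldr_fderiv (isOpen_slice_right hU s) l hfs hs' w).symm

/-- **(D2) at order `N` along `k + l = N`** (the word transported by `Fin.cast`; `subst`). [cite: HormanderALPDO1, §1.1 pp. 7–12] -/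
theorem iteratedFDeriv_apply_append_cast_eq_iteratedDeriv_slice {U : Set (ℝ × Z)} (hU : IsOpen U) {f : ℝ × Z → E}
    (hf : ContDiffOn ℝ ∞ f U) {N k l : ℕ} (h : k + l = N) (w : Fin l → Z) {x : ℝ × Z} (hx : x ∈ U) :
    iteratedFDeriv ℝ N f x
        (fun i => Fin.append (fun _ : Fin k => ((1 : ℝ), (0 : Z))) (fun j => ((0 : ℝ), w j)) (Fin.cast h.symm i)) =
      iteratedDeriv k (fun t : ℝ => iteratedFDeriv ℝ l (fun ζ : Z => f (t, ζ)) x.2 w) x.1 := by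
  subst h
  exact iteratedFDeriv_apply_append_eq_iteratedDeriv_slice hU hf k w hx

end Dictionary

/-! ## §4 (D3) Sorted product words: the `WithBot κ`-indexed product basis of `ℝ × Z` and the shape of monotone words -/

section Words

/-- **The product basis indexed by `WithBot κ`**: for a basis `b : κ → Z` there is a basis `B` of `ℝ × Z` indexed by `WithBot κ` with `B ⊥ = (1, 0)` and
`B ↑c = (0, b c)` (Mathlib `(Basis.singleton PUnit ℝ).prod b` reindexed along `PUnit ⊕ κ ≃ Option κ = WithBot κ`); `WithBot`'s order puts the `ℝ`-letter FIRST.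
[cite: HormanderALPDO1, §1.1 pp. 7–12] -/
theorem exists_basis_withBot_prod {κ Z : Type*} [AddCommGroup Z] [Module ℝ Z] (b : Module.Basis κ ℝ Z) :
    ∃ B : Module.Basis (WithBot κ) ℝ (ℝ × Z), B ⊥ = ((1 : ℝ), (0 : Z)) ∧ ∀ c : κ, B (c : WithBot κ) = ((0 : ℝ), b c) := by
  classical
  let e : Unit ⊕ κ ≃ WithBot κ := (Equiv.sumComm Unit κ).trans (Equiv.optionEquivSumPUnit κ).symm
  have hebot : e.symm ⊥ = Sum.inl () := rfl
  have hecoe : ∀ c : κ, e.symm (c : WithBot κ) = Sum.inr c := fun _ => rfl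
  refine ⟨((Module.Basis.singleton Unit ℝ).prod b).reindex e, ?_, fun c => ?_⟩
  · rw [Module.Basis.reindex_apply, hebot, Module.Basis.prod_apply]
    simp
  · rw [Module.Basis.reindex_apply, hecoe, Module.Basis.prod_apply]
    simp

/-- **(D3) MONOTONE WORDS INTO `WithBot κ` ARE `⊥^k ++ ↑∘I'`**: a monotone `I : Fin N → WithBot κ` takes the value `⊥` exactly on an initial block of length `k`, and on
the final block of length `l = N - k` it is `↑(I' j)` with `I' : Fin l → κ` monotone (`k` := the first index from which `⊥` no longer occurs, `Nat.find`).
[cite: HormanderALPDO1, §1.1 pp. 7–12] -/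
theorem exists_append_of_monotone_withBot {κ : Type*} [PartialOrder κ] {N : ℕ} {I : Fin N → WithBot κ} (hI : Monotone I) :
    ∃ k l : ℕ, ∃ h : k + l = N, ∃ I' : Fin l → κ, Monotone I' ∧
      ∀ i : Fin N, I i = Fin.append (fun _ : Fin k => (⊥ : WithBot κ)) (fun j => (I' j : WithBot κ)) (Fin.cast h.symm i) := by
  classical
  -- `k` := the first index from which `⊥` no longer occurs; by monotonicity `⊥` occurs exactly below `k`
  obtain ⟨k, hkN, hk, hk'⟩ : ∃ k : ℕ, k ≤ N ∧ (∀ i : Fin N, k ≤ i.val → I i ≠ ⊥) ∧ (∀ i : Fin N, i.val < k → I i = ⊥) := by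
    have hex : ∃ m : ℕ, ∀ i : Fin N, m ≤ i.val → I i ≠ ⊥ := ⟨N, fun i hi => absurd i.isLt (not_lt.2 hi)⟩
    refine ⟨Nat.find hex, Nat.find_min' hex fun i hi => absurd i.isLt (not_lt.2 hi), Nat.find_spec hex, fun i hi => ?_⟩
    obtain ⟨j, hij, hj⟩ : ∃ j : Fin N, i.val ≤ j.val ∧ I j = ⊥ := by simpa using Nat.find_min hex hi
    have hle : I i ≤ I j := hI (Fin.le_def.2 hij)
    rw [hj] at hle
    exact le_bot_iff.1 hle
  have hsum : k + (N - k) = N := Nat.add_sub_of_le hkN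
  have hne : ∀ j : Fin (N - k), I (Fin.cast hsum (Fin.natAdd k j)) ≠ ⊥ := fun j => hk _ (Nat.le_add_right k j.val)
  refine ⟨k, N - k, hsum, fun j => (I (Fin.cast hsum (Fin.natAdd k j))).unbot (hne j), fun j₁ j₂ hj => ?_, fun i => ?_⟩
  · apply WithBot.coe_le_coe.1
    rw [WithBot.coe_unbot, WithBot.coe_unbot]
    exact hI (Fin.le_def.2 (Nat.add_le_add_left (Fin.le_def.1 hj) k))
  · by_cases hi : i.val < k
    · have hc : Fin.cast hsum.symm i = Fin.castAdd (N - k) ⟨i.val, hi⟩ := Fin.ext rfl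
      rw [hc, Fin.append_left, hk' i hi]
    · have hki : k ≤ i.val := not_lt.1 hi
      have hlt : i.val - k < N - k := by have := i.isLt; omega
      have hc : Fin.cast hsum.symm i = Fin.natAdd k ⟨i.val - k, hlt⟩ :=
        Fin.ext (by show i.val = k + (i.val - k); omega)
      rw [hc, Fin.append_right, WithBot.coe_unbot]
      congr 1
      exact Fin.ext (by show i.val = k + (i.val - k); omega)

end Words

/-! ## §5 (D4) The head: bounded mixed partials `∂ₜᵏ ∂_ζ^{I'}` on `A` ⇒ `‖D^N f‖` bounded on `A` -/

section Head

/-- **MIXED PARTIALS ⇒ JOINT JET on `ℝ × Z`.**  Let `Z` be a real normed space with a finite basis `b : κ → Z`, `κ` linearly ordered, `f : ℝ × Z → E` of class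
`C^∞` on the open `U`, `A ⊆ U`.  If for every splitting `k + l = N` and every MONOTONE tangential word `I : Fin l → κ` the mixed partial
`x ↦ (d/dt)^k (t ↦ D^l (ζ ↦ f (t, ζ)) (x.2) [b ∘ I]) (x.1)` is bounded on `A`, then `‖D^N f (x)‖` is bounded on `A`.
Proof: SORTED words for the product basis `B` of §4 (indexed by `WithBot κ`, `ℝ`-letter first) suffice by Schwarz (★
`exists_forall_norm_iteratedFDeriv_le_of_foldr_fderiv_basis_monotone`); a sorted word is `(1,0)^k ++ (0, b∘I')` with `I'` monotone (D3), and its jet entry is the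
mixed partial by the dictionary (D2). [cite: HormanderALPDO1, §1.1 pp. 7–12, Thm. 1.1.8] [cite: Coleman2012, §4.5] -/
theorem exists_forall_norm_iteratedFDeriv_le_of_iteratedDeriv_partial {κ Z E : Type*} [Fintype κ] [LinearOrder κ]
    [NormedAddCommGroup Z] [NormedSpace ℝ Z] [NormedAddCommGroup E] [NormedSpace ℝ E] (b : Module.Basis κ ℝ Z)
    {U : Set (ℝ × Z)} (hU : IsOpen U) {A : Set (ℝ × Z)} (hAU : A ⊆ U) {f : ℝ × Z → E} (hf : ContDiffOn ℝ ∞ f U) {N : ℕ}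
    (hbd : ∀ k l : ℕ, k + l = N → ∀ I : Fin l → κ, Monotone I →
      ∃ B : ℝ, ∀ x ∈ A, ‖iteratedDeriv k (fun t : ℝ => iteratedFDeriv ℝ l (fun ζ : Z => f (t, ζ)) x.2 (fun j => b (I j))) x.1‖ ≤ B) :
    ∃ B : ℝ, ∀ x ∈ A, ‖iteratedFDeriv ℝ N f x‖ ≤ B := by
  obtain ⟨Bs, hBbot, hBcoe⟩ := exists_basis_withBot_prod b
  have hfN : ContDiffOn ℝ N f U := hf.of_le (by exact_mod_cast le_top)
  refine exists_forall_norm_iteratedFDeriv_le_of_foldr_fderiv_basis_monotone Bs hU hAU hfN fun I hI => ?_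
  obtain ⟨k, l, h, I', hI', hword⟩ := exists_append_of_monotone_withBot hI
  obtain ⟨B, hB⟩ := hbd k l h I' hI'
  refine ⟨B, fun x hx => ?_⟩
  have hxU : x ∈ U := hAU hx
  -- the sorted word `Bs ∘ I` is `(1,0)^k ++ (0, b ∘ I')`
  have hcomp : ∀ c : Fin (k + l),
      Bs (Fin.append (fun _ : Fin k => (⊥ : WithBot κ)) (fun j => (I' j : WithBot κ)) c) =
        Fin.append (fun _ : Fin k => ((1 : ℝ), (0 : Z))) (fun j => ((0 : ℝ), b (I' j))) c := by
    intro c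
    induction c using Fin.addCases with
    | left i => simp only [Fin.append_left, hBbot]
    | right j => simp only [Fin.append_right, hBcoe]
  have hw : (fun i => Bs (I i)) =
      fun i => Fin.append (fun _ : Fin k => ((1 : ℝ), (0 : Z))) (fun j => ((0 : ℝ), b (I' j))) (Fin.cast h.symm i) :=
    funext fun i => by rw [hword i, hcomp]
  rw [← iteratedFDeriv_apply_eq_foldr_fderiv hU N hfN hxU, hw,
    iteratedFDeriv_apply_append_cast_eq_iteratedDeriv_slice hU hf h (fun j => b (I' j)) hxU]
  exact hB x hx

end Head

/-! ## §6 (ED. 2) The general two-block dictionary on `P₁ × P₂` and the nested-jet bounds -/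

section TwoBlock

variable {P Q F : Type*} [NormedAddCommGroup P] [NormedSpace ℝ P] [NormedAddCommGroup Q] [NormedSpace ℝ Q]
  [NormedAddCommGroup F] [NormedSpace ℝ F]

/-- **(D1) THROUGH AN AFFINE PULL-BACK.**  For a continuous linear map `A : P →L[ℝ] Q`, a translate `c : Q`, letters `m : Fin l → P` and `G ∈ C^∞(O)`, `O ⊆ Q` open:
at every `p` with `A p + c ∈ O`, `(D_{A(m 0)} ⋯ D_{A(m (l-1))} G)(A p + c) = (D_{m 0} ⋯ D_{m (l-1)} (p' ↦ G (A p' + c)))(p)` — induction on the word, one chain rule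
`D(G ∘ (A · + c))(p')·v = DG(A p' + c)·(A v)` at a time, the outer word seeing only the germ on the open pull-back set (§1).
[cite: HormanderALPDO1, §1.1 (1.1.3) p. 8] [cite: Coleman2012, §4.5] -/
theorem foldr_fderiv_comp_clm_add_eq_foldr_fderiv {O : Set Q} (hO : IsOpen O) (A : P →L[ℝ] Q) (c : Q) {l : ℕ} (m : Fin l → P) :
    ∀ {G : Q → F}, ContDiffOn ℝ ∞ G O → ∀ {p : P}, A p + c ∈ O →
      Fin.foldr l (fun j (g : Q → F) => fun y => fderiv ℝ g y (A (m j))) G (A p + c) =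
        Fin.foldr l (fun j (h : P → F) => fun p' => fderiv ℝ h p' (m j)) (fun p' => G (A p' + c)) p := by
  induction l with
  | zero => intro G _ p _; simp
  | succ l ih =>
    intro G hG p hp
    rw [Fin.foldr_succ_last, Fin.foldr_succ_last]
    have hG' : ContDiffOn ℝ ∞ (fun y => fderiv ℝ G y (A (m (Fin.last l)))) O :=
      (hG.fderiv_of_isOpen hO (m := ∞) (by simp)).clm_apply contDiffOn_const
    rw [ih (fun j => m j.castSucc) hG' hp]
    have hOp : IsOpen {p' : P | A p' + c ∈ O} := hO.preimage (A.continuous.add continuous_const)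
    refine foldr_fderiv_congr_of_eqOn hOp (fun j => m j.castSucc) (fun p' hp' => ?_) hp
    -- one letter: `DG(A p' + c)·(A v) = D(G ∘ (A · + c))(p')·v`
    show fderiv ℝ G (A p' + c) (A (m (Fin.last l))) = fderiv ℝ (fun p'' => G (A p'' + c)) p' (m (Fin.last l))
    have hGd : HasFDerivAt G (fderiv ℝ G (A p' + c)) (A p' + c) :=
      ((hG.differentiableOn (by simp)).differentiableAt (hO.mem_nhds hp')).hasFDerivAt
    have hcomp := hGd.comp p' ((A.hasFDerivAt).add_const c)
    rw [show (fun p'' : P => G (A p'' + c)) = G ∘ (fun p'' : P => A p'' + c) from rfl, hcomp.fderiv,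
      ContinuousLinearMap.comp_apply]

end TwoBlock

section TwoBlockDictionary

variable {P₁ P₂ F : Type*} [NormedAddCommGroup P₁] [NormedSpace ℝ P₁] [NormedAddCommGroup P₂] [NormedSpace ℝ P₂]
  [NormedAddCommGroup F] [NormedSpace ℝ F]

/-- The inner `ζ`-jet entry of a slice, `p₁ ↦ D^l (p₂ ↦ Ψ (p₁, p₂)) (p₂) [m]`, agrees on the open slice set `{p₁ | (p₁, p₂) ∈ W}` with the slice of the nested
tangential word `D_{(0, m 0)} ⋯ D_{(0, m (l-1))} Ψ` (§6 (D1) with `A := inr`, `c := (p₁, 0)` + ★ `iteratedFDeriv_apply_eq_foldr_fderiv` for the `C^l` slice).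
[cite: HormanderALPDO1, §1.1 pp. 7–12] -/
theorem iteratedFDeriv_slice_apply_eq_foldr_inr {W : Set (P₁ × P₂)} (hW : IsOpen W) {Ψ : P₁ × P₂ → F}
    (hΨ : ContDiffOn ℝ ∞ Ψ W) {l : ℕ} (m : Fin l → P₂) {p₁ : P₁} {p₂ : P₂} (h : (p₁, p₂) ∈ W) :
    iteratedFDeriv ℝ l (fun q : P₂ => Ψ (p₁, q)) p₂ m =
      Fin.foldr l (fun j (g : P₁ × P₂ → F) => fun y => fderiv ℝ g y ((0 : P₁), m j)) Ψ (p₁, p₂) := by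
  have hWs : IsOpen {q : P₂ | (p₁, q) ∈ W} := hW.preimage (continuous_const.prodMk continuous_id)
  have hΨs : ContDiffOn ℝ l (fun q : P₂ => Ψ (p₁, q)) {q : P₂ | (p₁, q) ∈ W} :=
    (hΨ.of_le (by exact_mod_cast le_top)).comp (contDiff_prodMk_right p₁).contDiffOn fun _ hq => hq
  rw [iteratedFDeriv_apply_eq_foldr_fderiv hWs l hΨs h m]
  -- `(p₁, q) = inr q + (p₁, 0)`
  have hpt : ∀ q : P₂, ((0 : P₁), q) + (p₁, (0 : P₂)) = (p₁, q) := fun q => by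
    ext <;> simp
  have key := foldr_fderiv_comp_clm_add_eq_foldr_fderiv hW (ContinuousLinearMap.inr ℝ P₁ P₂) (p₁, (0 : P₂)) m hΨ
    (p := p₂) (by rw [ContinuousLinearMap.inr_apply, hpt]; exact h)
  simp only [ContinuousLinearMap.inr_apply, hpt] at key
  exact key.symm

/-- **(D2″, smoothness) THE INNER JET ENTRY IS `C^∞` IN THE OUTER VARIABLE**: for `Ψ ∈ C^∞(W)`, `W ⊆ P₁ × P₂` open, `p₂ : P₂`, `m : Fin l → P₂`,
`p₁ ↦ D^l (q ↦ Ψ (p₁, q)) (p₂) [m]` is `C^∞` on the slice set `{p₁ | (p₁, p₂) ∈ W}` (it is the slice of the `C^∞(W)` nested word `D_{(0,m)} Ψ`, §1).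
[cite: HormanderALPDO1, §1.1 pp. 7–12] [cite: Coleman2012, §4.5] -/
theorem contDiffOn_iteratedFDeriv_slice_apply {W : Set (P₁ × P₂)} (hW : IsOpen W) {Ψ : P₁ × P₂ → F}
    (hΨ : ContDiffOn ℝ ∞ Ψ W) {l : ℕ} (p₂ : P₂) (m : Fin l → P₂) :
    ContDiffOn ℝ ∞ (fun p₁ : P₁ => iteratedFDeriv ℝ l (fun q : P₂ => Ψ (p₁, q)) p₂ m) {p₁ : P₁ | (p₁, p₂) ∈ W} := by
  have hG : ContDiffOn ℝ ∞
      (Fin.foldr l (fun j (g : P₁ × P₂ → F) => fun y => fderiv ℝ g y ((0 : P₁), m j)) Ψ) W :=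
    contDiffOn_foldr_fderiv_apply hW (fun j => ((0 : P₁), m j)) hΨ
  have hslice : ContDiffOn ℝ ∞
      (fun p₁ : P₁ => Fin.foldr l (fun j (g : P₁ × P₂ → F) => fun y => fderiv ℝ g y ((0 : P₁), m j)) Ψ (p₁, p₂))
      {p₁ : P₁ | (p₁, p₂) ∈ W} :=
    hG.comp (contDiff_prodMk_left p₂).contDiffOn fun _ hp => hp
  exact hslice.congr fun p₁ hp₁ => iteratedFDeriv_slice_apply_eq_foldr_inr hW hΨ m hp₁

/-- **(D2′) THE GENERAL TWO-BLOCK DICTIONARY.**  For `Ψ ∈ C^∞(W)`, `W ⊆ P₁ × P₂` open, `x ∈ W`, letters `u : Fin k → P₁`, `m : Fin l → P₂`: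
`D^{k+l} Ψ (x) [(u 0, 0), …, (u (k-1), 0), (0, m 0), …, (0, m (l-1))] = D^k (p₁ ↦ D^l (p₂ ↦ Ψ (p₁, p₂)) (x.2) [m]) (x.1) [u]`
(★ `iteratedFDeriv_apply_append_eq_foldr_foldr`; §6 (D1) along `(u i, 0) = inl (u i)` at `x = inl x.1 + (0, x.2)` for the outer word and along `(0, m j)` for the inner
one; ★ `iteratedFDeriv_apply_eq_foldr_fderiv` backwards on each slice, the outer slice being `C^∞` by (D2″)). [cite: HormanderALPDO1, §1.1 pp. 7–12, Thm. 1.1.8]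
[cite: Coleman2012, §4.5] -/
theorem iteratedFDeriv_apply_append_inl_inr {W : Set (P₁ × P₂)} (hW : IsOpen W) {Ψ : P₁ × P₂ → F}
    (hΨ : ContDiffOn ℝ ∞ Ψ W) {x : P₁ × P₂} (hx : x ∈ W) {k l : ℕ} (u : Fin k → P₁) (m : Fin l → P₂) :
    iteratedFDeriv ℝ (k + l) Ψ x (Fin.append (fun i => ((u i, 0) : P₁ × P₂)) (fun j => ((0, m j) : P₁ × P₂))) =
      iteratedFDeriv ℝ k (fun p₁ : P₁ => iteratedFDeriv ℝ l (fun p₂ : P₂ => Ψ (p₁, p₂)) x.2 m) x.1 u := by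
  obtain ⟨x₁, x₂⟩ := x
  have hΨ' : ContDiffOn ℝ (k + l) Ψ W := hΨ.of_le (by exact_mod_cast le_top)
  rw [iteratedFDeriv_apply_append_eq_foldr_foldr hW hΨ' hx]
  set G : P₁ × P₂ → F := Fin.foldr l (fun j (g : P₁ × P₂ → F) => fun y => fderiv ℝ g y ((0 : P₁), m j)) Ψ with hG
  have hGs : ContDiffOn ℝ ∞ G W := contDiffOn_foldr_fderiv_apply hW (fun j => ((0 : P₁), m j)) hΨ
  -- outer word along `inl (u i)` at `inl x₁ + (0, x₂)`
  have hpt : ∀ p₁ : P₁, (p₁, (0 : P₂)) + ((0 : P₁), x₂) = (p₁, x₂) := fun p₁ => by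
    ext <;> simp
  have hout := foldr_fderiv_comp_clm_add_eq_foldr_fderiv hW (ContinuousLinearMap.inl ℝ P₁ P₂) ((0 : P₁), x₂) u hGs
    (p := x₁) (by rw [ContinuousLinearMap.inl_apply, hpt]; exact hx)
  simp only [ContinuousLinearMap.inl_apply, hpt] at hout
  change Fin.foldr k (fun i (g : P₁ × P₂ → F) => fun y => fderiv ℝ g y (u i, (0 : P₂))) G (x₁, x₂) = _
  rw [hout]
  -- the slice `p₁ ↦ G (p₁, x₂)` is the inner jet entry on the open slice set
  have hO : IsOpen {p₁ : P₁ | (p₁, x₂) ∈ W} := hW.preimage (continuous_id.prodMk continuous_const)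
  have heq : EqOn (fun p₁ : P₁ => G (p₁, x₂))
      (fun p₁ : P₁ => iteratedFDeriv ℝ l (fun p₂ : P₂ => Ψ (p₁, p₂)) x₂ m) {p₁ : P₁ | (p₁, x₂) ∈ W} :=
    fun p₁ hp₁ => (iteratedFDeriv_slice_apply_eq_foldr_inr hW hΨ m hp₁).symm
  rw [foldr_fderiv_congr_of_eqOn hO u heq hx]
  have hF : ContDiffOn ℝ k (fun p₁ : P₁ => iteratedFDeriv ℝ l (fun p₂ : P₂ => Ψ (p₁, p₂)) x₂ m) {p₁ : P₁ | (p₁, x₂) ∈ W} :=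
    (contDiffOn_iteratedFDeriv_slice_apply hW hΨ x₂ m).of_le (by exact_mod_cast le_top)
  exact (iteratedFDeriv_apply_eq_foldr_fderiv hO k hF hx u).symm

/-- **(D2″, bound) NESTED-JET BOUND**: for `Ψ ∈ C^∞(W)`, `W ⊆ P₁ × P₂` open, `x ∈ W`:
`‖D^k (p₁ ↦ D^l (q ↦ Ψ (p₁, q)) (x.2) [m]) (x.1)‖ ≤ ‖D^{k+l} Ψ (x)‖ · ∏ j ‖m j‖` — (D2′) on entries, `ContinuousMultilinearMap.opNorm_le_bound` ∕ `le_opNorm`, and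
`‖(u i, 0)‖ = ‖u i‖`, `‖(0, m j)‖ = ‖m j‖` in the sup norm of the product. [cite: HormanderALPDO1, §1.1 pp. 7–12, Thm. 1.1.8] -/
theorem norm_iteratedFDeriv_slice_apply_le {W : Set (P₁ × P₂)} (hW : IsOpen W) {Ψ : P₁ × P₂ → F}
    (hΨ : ContDiffOn ℝ ∞ Ψ W) {x : P₁ × P₂} (hx : x ∈ W) (k l : ℕ) (m : Fin l → P₂) :
    ‖iteratedFDeriv ℝ k (fun p₁ : P₁ => iteratedFDeriv ℝ l (fun q : P₂ => Ψ (p₁, q)) x.2 m) x.1‖ ≤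
      ‖iteratedFDeriv ℝ (k + l) Ψ x‖ * ∏ j, ‖m j‖ := by
  refine ContinuousMultilinearMap.opNorm_le_bound (by positivity) fun u => ?_
  rw [← iteratedFDeriv_apply_append_inl_inr hW hΨ hx u m]
  refine (ContinuousMultilinearMap.le_opNorm _ _).trans (le_of_eq ?_)
  rw [Fin.prod_univ_add]
  simp only [Fin.append_left, Fin.append_right, Prod.norm_mk, norm_zero, max_eq_left (norm_nonneg _),
    max_eq_right (norm_nonneg _)]
  ring

end TwoBlockDictionary

end Literature.Analysis.Calculus

end
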